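import Summits.RiemannHypothesis.RiemannHypothesis.Theorems.SemilocalSoninArchWindow
import HarnessLib

/-!
# Below its first prime a semilocal Weil sum is archimedean; the Sonin inequality at `S = {∞, p}` below `(log p)/2`

Cell `rh-explicit`, seat cc-s2-1 (gen 7; A4 SEMILOCAL-TABLE, Sonin column for the single-prime rows
`S = {∞,3}`, `{∞,5}`).  The `p`-sharp form of gen 6's typing lemmas (`SemilocalSoninArchWindow`, window
`log 2` for every `S`): PROVED, elementary, no named fact, no RH claim.

* `weilSemilocalCoeff_eq_zero_of_lt_of_forall_le` — if every element of `S` is `≥ P` then the `S`-smooth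
  coefficient `Λ_S(n)/√n` vanishes for every `n < P` (`Λ(0) = Λ(1) = 0`; an `n ≥ 2` with all prime factors
  in `S` is divisible by one of them, hence `≥ P`).
* `weilSemilocalPrimeTerm_eq_zero_of_forall_le` — **locality**: for such `S` and a continuous `k` with
  `tsupport k ⊆ [−log P, log P]`, `W_S-prime(k) = 0`; in particular (`S = {p}`, `P = p`)
  `weilSemilocalPrimeTerm_singleton_eq_zero`, and on windows `supp g ⊆ [−a, a]`, `a ≤ (log p)/2`,
  `weilSemilocalPrimeTerm_singleton_weilConv_eq_zero_of_le`.
* `semilocalSoninIneqOn_iff_arch_of_le_half_log` — for `a ≤ (log p)/2` the statement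
  `SemilocalSoninIneqOn p a` is LITERALLY its `W_p`-free form (Connes–Consani 2021 Theorem 1 with
  `S(1,1)` replaced by the twisted space `θ_p S(1,1)`): below the prime's entry point `(log p)/2` the prime
  acts on the operator inequality ONLY through the twist.  Gen 6 had this for `a ≤ (log 2)/2` and every
  `p`; for `p ≥ 3` the window `((log 2)/2, (log p)/2]` is exactly where the cell's DATA question lives
  (pre-registration `PREREG-ccs21-g7-sonin-p3p5`, sha256 `c2d7e0b3…`).
-/

set_option linter.dupNamespace false  -- the mandated namespace repeats `RiemannHypothesis`

noncomputable section

open MeasureTheory Complex Set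
open scoped Real

namespace Summit.RiemannHypothesis.RiemannHypothesis

open Literature.NumberTheory.LFunctions Literature.NumberTheory.ConnesConsani2021

/-- If every element of `S` is at least `P`, the `S`-smooth coefficient `Λ_S(n)/√n` vanishes for all
`n < P`: for `n ≤ 1` because `Λ(n) = 0`, and for `n ≥ 2` because a prime factor of `n` lying in `S`
would give `P ≤ q ≤ n`. [folklore] -/
theorem weilSemilocalCoeff_eq_zero_of_lt_of_forall_le {S : Finset ℕ} {P : ℕ}
    (hS : ∀ q ∈ S, P ≤ q) {n : ℕ} (hn : n < P) : weilSemilocalCoeff S n = 0 := by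
  unfold weilSemilocalCoeff
  split_ifs with hsub
  · rcases Nat.lt_or_ge n 2 with h2 | h2
    · interval_cases n <;> simp
    · exfalso
      obtain ⟨q, hq⟩ := (Nat.nonempty_primeFactors).2 h2
      have hqS : q ∈ S := hsub hq
      have hqn : q ≤ n := Nat.le_of_mem_primeFactors hq
      have := hS q hqS
      omega
  · rfl

/-- **Locality of the semilocal prime term.**  If every element of `S` is `≥ P` and `k` is continuous
with `tsupport k ⊆ [−log P, log P]`, then `Σ_{n : pf(n) ⊆ S} Λ(n) n^{-1/2}(k(log n) + k(−log n)) = 0`: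
by `weilSemilocalPrimeTerm_eq_sum_of_tsupport_subset` only `n ≤ P − 1` could enter, and those
coefficients vanish. [cite: Yoshida1992, §0 and §2 eq. (2.1) (supp F ⊆ [−2a, 2a]: only p^m ≤ e^{2a} enter)] -/
theorem weilSemilocalPrimeTerm_eq_zero_of_forall_le {S : Finset ℕ} {P : ℕ} (hP : 1 ≤ P)
    (hS : ∀ q ∈ S, P ≤ q) {k : ℝ → ℂ} (hk : Continuous k)
    (h : tsupport k ⊆ Icc (-Real.log P) (Real.log P)) :
    weilSemilocalPrimeTerm S k = 0 := by
  have hcast : ((P - 1 : ℕ) : ℝ) + 1 = (P : ℝ) := by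
    rw [Nat.cast_sub hP]; push_cast; ring
  have h' : tsupport k ⊆ Icc (-Real.log (((P - 1 : ℕ) : ℝ) + 1)) (Real.log (((P - 1 : ℕ) : ℝ) + 1)) := by
    rwa [hcast]
  rw [weilSemilocalPrimeTerm_eq_sum_of_tsupport_subset S hk (P - 1) h']
  refine Finset.sum_eq_zero fun n hn ↦ ?_
  have hnP : n < P := by
    have := Finset.mem_range.1 hn
    omega
  rw [weilSemilocalCoeff_eq_zero_of_lt_of_forall_le hS hnP]
  simp

/-- `S = {p}`: a continuous `k` with `tsupport k ⊆ [−log p, log p]` has `W_{{p}}-prime(k) = 0` — the prime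
`p` does not enter below `log p` (boundary included: the support of a continuous function is open). [folklore] -/
theorem weilSemilocalPrimeTerm_singleton_eq_zero {p : ℕ} [hp : Fact p.Prime] {k : ℝ → ℂ}
    (hk : Continuous k) (h : tsupport k ⊆ Icc (-Real.log p) (Real.log p)) :
    weilSemilocalPrimeTerm {p} k = 0 :=
  weilSemilocalPrimeTerm_eq_zero_of_forall_le hp.out.one_lt.le (fun q hq ↦ by
    rw [Finset.mem_singleton.1 hq]) hk h

/-- On a window `supp g ⊆ [−a, a]` with `a ≤ (log p)/2` the `{p}`-prime term of `g ⋆ g̃` vanishes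
(`supp (g ⋆ g̃) ⊆ [−2a, 2a] ⊆ [−log p, log p]`). [cite: Yoshida1992, §2 (supp F ⊆ [−2a, 2a])] -/
theorem weilSemilocalPrimeTerm_singleton_weilConv_eq_zero_of_le {p : ℕ} [Fact p.Prime] {a : ℝ}
    (ha : a ≤ Real.log p / 2) {g : ℝ → ℂ} (hg : IsWeilTest g) (hsupp : tsupport g ⊆ Icc (-a) a) :
    weilSemilocalPrimeTerm {p} (weilConv g (weilReflect g)) = 0 :=
  weilSemilocalPrimeTerm_singleton_eq_zero (hg.weilConv hg.weilReflect).1.continuous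
    ((tsupport_weilConv_weilReflect_subset hg.2 hsupp).trans
      (Icc_subset_Icc (by linarith) (by linarith)))

/-- **Below the prime's entry point the semilocal Sonin inequality is purely archimedean.**  For
`a ≤ (log p)/2`, `SemilocalSoninIneqOn p a` is equivalent to its `W_p`-free form
`Σ_i Re⟨ξ_i|ϑ(g⋆g̃)ξ_i⟩ ≤ Re W_∞(g⋆g̃)` over orthonormal families of the twisted Sonin space
`θ_p S(1,1)` — Connes–Consani 2021 Theorem 1 with Sonin's space replaced by its `θ_p`-image; the prime
acts only through the twist.  The `p`-sharp form of `semilocalSoninIneqOn_iff_arch_of_le`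
(window `(log 2)/2`). [cite: ConnesConsani2021, Thm. 1 (Intro p. 4) — the archimedean shape being compared] -/
theorem semilocalSoninIneqOn_iff_arch_of_le_half_log {p : ℕ} [Fact p.Prime] {a : ℝ}
    (ha : a ≤ Real.log p / 2) :
    SemilocalSoninIneqOn p a ↔
      ∀ g : ℝ → ℂ, IsWeilTest g → tsupport g ⊆ Icc (-a) a →
        mulFourier g (I / 2) = 0 → mulFourier g 0 = 0 →
        ∀ (n : ℕ) (ξ : Fin n → Lp ℂ 2 (volume : Measure ℝ)),
          Orthonormal ℂ ξ → (∀ i, ξ i ∈ semilocalSoninSpace p 1 1) →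
            ∑ i, (soninTraceForm (weilConv g (weilReflect g)) (ξ i : ℝ → ℂ)).re
              ≤ (archW (weilConv g (weilReflect g))).re := by
  constructor
  · intro h g hg hsupp h1 h0 n ξ hξ hS
    have key := h g hg hsupp h1 h0 n ξ hξ hS
    rwa [weilSemilocalPrimeTerm_singleton_weilConv_eq_zero_of_le ha hg hsupp, sub_zero] at key
  · intro h g hg hsupp h1 h0 n ξ hξ hS
    rw [weilSemilocalPrimeTerm_singleton_weilConv_eq_zero_of_le ha hg hsupp, sub_zero]
    exact h g hg hsupp h1 h0 n ξ hξ hS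

/-- Monotonicity restated at the prime's window: if the inequality holds at `a = (log p)/2` it holds on
every smaller window, where it is the archimedean statement on `θ_p S(1,1)`. [folklore] -/
theorem semilocalSoninIneqOn_arch_of_le_half_log {p : ℕ} [Fact p.Prime] {a : ℝ}
    (ha : a ≤ Real.log p / 2) (h : SemilocalSoninIneqOn p (Real.log p / 2)) :
    ∀ g : ℝ → ℂ, IsWeilTest g → tsupport g ⊆ Icc (-a) a →
        mulFourier g (I / 2) = 0 → mulFourier g 0 = 0 →
        ∀ (n : ℕ) (ξ : Fin n → Lp ℂ 2 (volume : Measure ℝ)),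
          Orthonormal ℂ ξ → (∀ i, ξ i ∈ semilocalSoninSpace p 1 1) →
            ∑ i, (soninTraceForm (weilConv g (weilReflect g)) (ξ i : ℝ → ℂ)).re
              ≤ (archW (weilConv g (weilReflect g))).re :=
  (semilocalSoninIneqOn_iff_arch_of_le_half_log ha).1 (h.mono ha)

end Summit.RiemannHypothesis.RiemannHypothesis
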